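import Mathlib
import HarnessLib
import Summits.Langlands.Langlands.Theses.FrobeniusMomentIrreducibility

/-!
# Birth skeleton (BC3) for crux stmt-Langlands-19273
`Summit.Langlands.Langlands.Theses.FrobeniusMomentIrreducibility.TraceCorrelationNonneg` — line `birth`

Route `route-Langlands-FrobeniusMomentIrreducibility` (`closes : MeanSquareTraceAtLeastOne →
TraceCorrelationNonneg → PairLPoleJS → IrreducibleOfMoments → RestOfReciprocity → Langlands`).
The crux (rank 3, item (B) of the Frobenius-moment line) says: for a number field `F`, ranks
`m₁, m₂`, a prime `ℓ`, `ι : ℚ̄_ℓ ≃ ℂ` and framed `ρ₁ : Γ_F → GL_{m₁}(ℚ̄_ℓ)`, `ρ₂ : Γ_F → GL_{m₂}(ℚ̄_ℓ)`,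
both unramified at almost all places and de Rham above `ℓ`, with `P_v(ρ₁) P_v(ρ₂)` `ι`-pure of one
weight `w ∈ ℤ` at almost all `v`, and every `ε > 0`: for real `σ > 1` close to `1`,
`Σ_v Re(ι tr ρ₁(Frob_v) · conj ι tr ρ₂(Frob_v)) · N(v)^{-(w+σ)} ≥ -ε · log(1/(σ-1))`.

This file concludes the crux BY NAME from three named stubs, cut along the dévissage
"reduce to IRREDUCIBLE constituents, then split the pairs into trace-equal (diagonal, `≥ 0`) and
trace-distinct (the open Rankin–Selberg heart)":

* `stub_correlation_nonIsomorphic` — THE HEART (hardest stub, open-problem / XL): the crux's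
  inequality for a pair of IRREDUCIBLE `ρ₁`, `ρ₂` of positive ranks whose Frobenius traces do NOT
  agree at almost every place (so, by Chebotarev + Brauer–Nesbitt, `ρ₁ ≇ ρ₂`).  Why plausibly true:
  it is the prime-sum shadow of "`L(s, ρ₁ × ρ₂^∨)` has neither zero nor pole at `s = 1`" for
  non-isomorphic irreducible pure pairs — a theorem whenever both are automorphic (Jacquet–Shalika
  non-vanishing on `Re s = 1`, Shahidi) and for Artin / CM / potentially automorphic pairs; for
  characters it is Hecke's `L(1, χ) ≠ 0`.  Why it might fail: two non-isomorphic irreducibles with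
  `ι`-traces anti-aligned on a density-one set of primes, in a regime with no automorphy in sight.
  Leans on: `FramedGaloisRep`, `GaloisRep.frobTrace`, `GaloisRep.frobCharpoly`,
  `FramedGaloisRep.IsUnramifiedAt`, `fontainePstAdicCompletion`, `IsDeRhamFramed` (tree).
* `stub_correlation_assembly` — ANALYTIC ASSEMBLY OVER CONSTITUENTS (true; size M): if two trace
  functions `T₁`, `T₂` on the finite places are, off a finite set, the sums of finitely many
  functions `t i`, `s j` each bounded by `C · N(v)^{w/2}` off a finite set, and EVERY pair `(i, j)`
  satisfies the `-ε log(1/(σ-1))` lower bound, then so does `(T₁, T₂)`.  Proof sketch: for `σ > 1`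
  every pair summand is absolutely summable (`≤ C² N(v)^{-σ}`, Dedekind zeta), so
  `Σ' Re(T₁ T̄₂) N^{-(w+σ)} = Σ_{i,j} Σ' Re(tᵢ s̄ⱼ) N^{-(w+σ)} + D(σ)` with `D` a finite sum over the
  exceptional places, bounded for `σ ∈ (1, 2)`; apply the pair bounds with `ε / (k₁ k₂ + 1)` and
  absorb the constant since `log(1/(σ-1)) → ∞`.  Leans on: Mathlib `tsum`, `Real.log`,
  `HeightOneSpectrum.residueCard`; tree `summable` lemmas for `Σ_v N(v)^{-σ}`.
* `stub_frobenius_devissage` — FROBENIUS-LEVEL DÉVISSAGE (true; size M): an a.e.-unramified,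
  de-Rham-above-`ℓ` framed `ρ` of rank `m` has finitely many IRREDUCIBLE constituents `r i` of
  positive ranks `d i`, each a.e. unramified and de Rham above `ℓ`, with
  `P_v(ρ) = ∏ᵢ P_v(r i)`, each `P_v(r i)` monic of degree `d i`, at almost every `v` (`m = 0`:
  `k = 0`, `P_v(ρ) = 1`).  Proof sketch: the landed Jordan–Hölder dévissage
  `Summit.Langlands.Langlands.Theorems.exists_geometricConstituents` (with `stub_deRhamBlocks`
  discharging its `D1` hypothesis) gives `charpoly (ρ g) = ∏ charpoly (r i g)` for all `g` and
  unramifiedness of the blocks; evaluate at a Frobenius with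
  `GaloisRep.IsUnramifiedAt.frobCharpoly_eq_charpoly` and `Matrix.charpoly_monic` /
  `Matrix.charpoly_natDegree_eq_dim`.  Leans on those tree / Mathlib declarations by name.

Shape (for `ledger skeleton check`): each stub is `theorem stub_<name> (binders) : <conclusion> := by
sorry`; `_Goal.stub_<name> : Prop := type_of% @stub_<name>` names that statement; the composition
`TraceCorrelationNonneg_of (h₁ : _Goal.stub_correlation_nonIsomorphic)
(h₂ : _Goal.stub_correlation_assembly) (h₃ : _Goal.stub_frobenius_devissage) :
TraceCorrelationNonneg` is proved WITHOUT `sorry` and concludes the route decl BY NAME: dévissage of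
`ρ₁` and `ρ₂` (stub 3); trace additivity and the bound `‖ι tr r i(Frob_v)‖ ≤ dᵢ N(v)^{w/2}` (all
roots of `P_v(r i) ∣ P_v(ρ₁) P_v(ρ₂)` have absolute value `N(v)^{w/2}`, and `-nextCoeff` is the sum
of the roots) feed stub 2; each pair `(r i, s j)` is either trace-equal at almost all places — then
its correlation sum is, up to finitely many places, the diagonal sum `Σ |ι tr r i|² N^{-(w+σ)} ≥ 0`,
handled by stub 2 again with `k₁ = k₂ = 1` — or not, and then it is literally stub 1.  The last
`example` feeds the stubs to the composition.  No new definition is introduced: every stub is stated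
over the route decl's own vocabulary.

Disproof used: none — `ledger crux ls stmt-Langlands-19273` shows no `Disproof.lean` (no workfiles
before this line); the item carries no refuter / stub-false / line-dead notes; the negatives index
(`ledger negatives --problem Langlands`: 16951 MonomialSerreAtSplitPrimes, 16822, 3797, and 17212
`OrdinaryPrimeTransport.RankinSelbergPoleCount` — an `n = 0` vacuity witness against a purity-free
pole count whose conclusion is `False` at rank `0`) has no statement of this shape; stub 1 carries
the guards `0 < m₁`, `0 < m₂` and irreducibility, and stubs 2–3 are true at rank / length `0`.
BC3 probes: see the registrar's NOTES.md (`bc/probes.lean`: the three stub statements restated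
verbatim as `def Sᵢ : Prop` in a file WITHOUT the sorried stubs, battery
`first | exact? | simpa [Sᵢ] | (unfold Sᵢ; simpa) | aesop`, `maxHeartbeats 400000`, against the crux
and against `Langlands`: all must fail).
-/

set_option linter.dupNamespace false

noncomputable section

namespace Summit.Langlands.Langlands.Cruxes.TraceCorrelationNonneg.Birth

open Summit.Langlands.Langlands.Theses.FrobeniusMomentIrreducibility
open scoped BigOperators Topology NumberField ComplexConjugate Polynomial
open Filter
open NumberField IsDedekindDomain Polynomial
open Literature.NumberTheory.GaloisRepresentations Literature.NumberTheory.PAdicHodge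

/-! ## 1. The three stubs -/

/-- **STUB 1 — THE NON-ISOMORPHIC IRREDUCIBLE HEART.**  For a number field `F`, positive ranks
`m₁, m₂`, a prime `ℓ`, `ι : ℚ̄_ℓ ≃ ℂ`, IRREDUCIBLE framed `ρ₁ : Γ_F → GL_{m₁}(ℚ̄_ℓ)`,
`ρ₂ : Γ_F → GL_{m₂}(ℚ̄_ℓ)`, both unramified at almost all places and de Rham above `ℓ`, with
`P_v(ρ₁) P_v(ρ₂)` `ι`-pure of weight `w` at almost all `v`, and whose Frobenius traces are NOT equal
at almost every place: for every `ε > 0` and real `σ > 1` close to `1`,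
`Σ_v Re(ι tr ρ₁(Frob_v) · conj ι tr ρ₂(Frob_v)) N(v)^{-(w+σ)} ≥ -ε log(1/(σ-1))`.
Why plausibly true: the prime-sum form of holomorphy and non-vanishing of `L(s, ρ₁ × ρ₂^∨)` at
`s = 1` for non-isomorphic irreducible pure pairs (known for automorphic pairs: Jacquet–Shalika,
Shahidi; for characters: Hecke).  Why it might fail: anti-aligned traces on a density-one set of
primes for a pair with no automorphy available.  Hardest stub; size open-problem / XL.
[cite: doi:10.1007/bf01390166] [cite: doi:10.2307/2374050] [cite: doi:10.1155/S1073792898000117]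
[cite: doi:10.1007/BF02698692] -/
theorem stub_correlation_nonIsomorphic (F : Type) [Field F] [NumberField F] (m₁ m₂ : ℕ)
    (hm₁ : 0 < m₁) (hm₂ : 0 < m₂) (ℓ : ℕ) [Fact ℓ.Prime] (ι : PadicAlgCl ℓ ≃+* ℂ)
    (ρ₁ : FramedGaloisRep F (PadicAlgCl ℓ) m₁) (ρ₂ : FramedGaloisRep F (PadicAlgCl ℓ) m₂) (w : ℤ)
    (hirr₁ : ρ₁.toGaloisRep.IsIrreducible) (hirr₂ : ρ₂.toGaloisRep.IsIrreducible)
    (hur : ∀ᶠ v : HeightOneSpectrum (𝓞 F) in cofinite, ρ₁.IsUnramifiedAt v ∧ ρ₂.IsUnramifiedAt v)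
    (hdR : ∀ (v : HeightOneSpectrum (𝓞 F)) (hv : ((ℓ : ℕ) : 𝓞 F) ∈ v.asIdeal),
      (fontainePstAdicCompletion v ℓ hv).IsDeRhamFramed (ρ₁.toLocal v) ∧
        (fontainePstAdicCompletion v ℓ hv).IsDeRhamFramed (ρ₂.toLocal v))
    (hpure : ∀ᶠ v : HeightOneSpectrum (𝓞 F) in cofinite,
      ∀ z ∈ ((ρ₁.toGaloisRep.frobCharpoly v * ρ₂.toGaloisRep.frobCharpoly v).map
        (ι : PadicAlgCl ℓ ≃+* ℂ).toRingHom).roots, ‖z‖ = (v.residueCard : ℝ) ^ ((w : ℝ) / 2))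
    (hne : ¬ ∀ᶠ v : HeightOneSpectrum (𝓞 F) in cofinite,
      ρ₁.toGaloisRep.frobTrace v = ρ₂.toGaloisRep.frobTrace v) :
    ∀ ε : ℝ, 0 < ε → ∀ᶠ σ : ℝ in 𝓝[>] (1 : ℝ),
      -(ε * Real.log (1 / (σ - 1))) ≤
        ∑' v : HeightOneSpectrum (𝓞 F),
          ((ι : PadicAlgCl ℓ ≃+* ℂ) (ρ₁.toGaloisRep.frobTrace v) *
              (starRingEnd ℂ) ((ι : PadicAlgCl ℓ ≃+* ℂ) (ρ₂.toGaloisRep.frobTrace v))).re *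
            (v.residueCard : ℝ) ^ (-((w : ℝ) + σ)) := by
  sorry

/-- **STUB 2 — ANALYTIC ASSEMBLY OVER CONSTITUENTS.**  Let `T₁, T₂` and `t i` (`i < k₁`), `s j`
(`j < k₂`) be complex functions on the finite places of the number field `F` such that, off a finite
set of places, `T₁ = Σᵢ tᵢ`, `T₂ = Σⱼ sⱼ` and `‖tᵢ(v)‖, ‖sⱼ(v)‖ ≤ C N(v)^{w/2}`; if every pair
`(tᵢ, sⱼ)` satisfies "for every `ε > 0`, for `σ > 1` close to `1`,
`Σ'_v Re(tᵢ(v) conj sⱼ(v)) N(v)^{-(w+σ)} ≥ -ε log(1/(σ-1))`", then so does `(T₁, T₂)`.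
Why true: for `σ > 1` all pair summands are absolutely summable (`≤ C² N(v)^{-σ}`), so the
`(T₁, T₂)` sum is the finite sum of the pair sums plus a finite sum over the exceptional places,
bounded for `σ ∈ (1, 2)`; use the pair bounds with `ε / (k₁ k₂ + 1)` and `log(1/(σ-1)) → +∞`.
Size M (bookkeeping with `tsum` over a finite exceptional set and Dedekind-zeta summability).
[folklore] -/
theorem stub_correlation_assembly (F : Type) [Field F] [NumberField F] (k₁ k₂ : ℕ) (w : ℤ) (C : ℝ)
    (T₁ T₂ : HeightOneSpectrum (𝓞 F) → ℂ) (t : Fin k₁ → HeightOneSpectrum (𝓞 F) → ℂ)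
    (s : Fin k₂ → HeightOneSpectrum (𝓞 F) → ℂ)
    (hT : ∀ᶠ v : HeightOneSpectrum (𝓞 F) in cofinite, T₁ v = ∑ i, t i v ∧ T₂ v = ∑ j, s j v)
    (hb : ∀ᶠ v : HeightOneSpectrum (𝓞 F) in cofinite,
      (∀ i, ‖t i v‖ ≤ C * (v.residueCard : ℝ) ^ ((w : ℝ) / 2)) ∧
        ∀ j, ‖s j v‖ ≤ C * (v.residueCard : ℝ) ^ ((w : ℝ) / 2))
    (hpair : ∀ i j, ∀ ε : ℝ, 0 < ε → ∀ᶠ σ : ℝ in 𝓝[>] (1 : ℝ),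
      -(ε * Real.log (1 / (σ - 1))) ≤
        ∑' v : HeightOneSpectrum (𝓞 F),
          (t i v * (starRingEnd ℂ) (s j v)).re * (v.residueCard : ℝ) ^ (-((w : ℝ) + σ))) :
    ∀ ε : ℝ, 0 < ε → ∀ᶠ σ : ℝ in 𝓝[>] (1 : ℝ),
      -(ε * Real.log (1 / (σ - 1))) ≤
        ∑' v : HeightOneSpectrum (𝓞 F),
          (T₁ v * (starRingEnd ℂ) (T₂ v)).re * (v.residueCard : ℝ) ^ (-((w : ℝ) + σ)) := by
  sorry

/-- **STUB 3 — FROBENIUS-LEVEL DÉVISSAGE INTO IRREDUCIBLE CONSTITUENTS.**  A framed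
`ρ : Γ_F → GL_m(ℚ̄_ℓ)` over a number field, unramified at almost all places and de Rham above `ℓ`
(Fontaine's pinned datum), has finitely many IRREDUCIBLE framed constituents `r i` of positive ranks
`d i`, each unramified at almost all places and de Rham above `ℓ`, such that at almost every place
`P_v(ρ) = ∏ᵢ P_v(r i)` with each `P_v(r i)` monic of degree `d i` (for `m = 0`: no constituents and
`P_v(ρ) = 1`).  Why true: the landed Jordan–Hölder dévissage
`Summit.Langlands.Langlands.Theorems.exists_geometricConstituents` (its `D1` hypothesis is the
landed `stub_deRhamBlocks`) gives `charpoly (ρ g) = ∏ᵢ charpoly (r i g)` for every `g ∈ Γ_F` and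
unramifiedness of the blocks wherever `ρ` is unramified; evaluate at an arithmetic Frobenius
(`GaloisRep.IsUnramifiedAt.frobCharpoly_eq_charpoly`, `HasFrobCharpolyAt.unique_holds`) and use
`Matrix.charpoly_monic`, `Matrix.charpoly_natDegree_eq_dim`.  Size M. [folklore] -/
theorem stub_frobenius_devissage (F : Type) [Field F] [NumberField F] (ℓ : ℕ) [Fact ℓ.Prime]
    (m : ℕ) (ρ : FramedGaloisRep F (PadicAlgCl ℓ) m)
    (hur : ∀ᶠ v : HeightOneSpectrum (𝓞 F) in cofinite, ρ.IsUnramifiedAt v)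
    (hdR : ∀ (v : HeightOneSpectrum (𝓞 F)) (hv : ((ℓ : ℕ) : 𝓞 F) ∈ v.asIdeal),
      (fontainePstAdicCompletion v ℓ hv).IsDeRhamFramed (ρ.toLocal v)) :
    ∃ (k : ℕ) (d : Fin k → ℕ) (r : ∀ i, FramedGaloisRep F (PadicAlgCl ℓ) (d i)),
      (∀ i, 0 < d i ∧ (r i).toGaloisRep.IsIrreducible ∧
        (∀ᶠ v : HeightOneSpectrum (𝓞 F) in cofinite, (r i).IsUnramifiedAt v) ∧
          ∀ (v : HeightOneSpectrum (𝓞 F)) (hv : ((ℓ : ℕ) : 𝓞 F) ∈ v.asIdeal),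
            (fontainePstAdicCompletion v ℓ hv).IsDeRhamFramed ((r i).toLocal v)) ∧
      ∀ᶠ v : HeightOneSpectrum (𝓞 F) in cofinite,
        ρ.toGaloisRep.frobCharpoly v = ∏ i, (r i).toGaloisRep.frobCharpoly v ∧
          ∀ i, ((r i).toGaloisRep.frobCharpoly v).Monic ∧
            ((r i).toGaloisRep.frobCharpoly v).natDegree = d i := by
  sorry

/-! ## 2. The stub statements as named `Prop`s (literally the types of the stubs; no `sorry` inherited) -/

namespace _Goal

/-- The statement of `stub_correlation_nonIsomorphic`, as a named `Prop` (literally its type). [folklore] -/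
def stub_correlation_nonIsomorphic : Prop :=
  type_of% @Summit.Langlands.Langlands.Cruxes.TraceCorrelationNonneg.Birth.stub_correlation_nonIsomorphic

/-- The statement of `stub_correlation_assembly`, as a named `Prop` (literally its type). [folklore] -/
def stub_correlation_assembly : Prop :=
  type_of% @Summit.Langlands.Langlands.Cruxes.TraceCorrelationNonneg.Birth.stub_correlation_assembly

/-- The statement of `stub_frobenius_devissage`, as a named `Prop` (literally its type). [folklore] -/
def stub_frobenius_devissage : Prop :=
  type_of% @Summit.Langlands.Langlands.Cruxes.TraceCorrelationNonneg.Birth.stub_frobenius_devissage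

end _Goal

/-! ## 3. Elementary glue lemmas (no `sorry`) -/

/-- `log(1/(σ-1)) > 0` for `σ ∈ (1, 2)`, hence for `σ > 1` close to `1`. [folklore] -/
theorem eventually_log_pos : ∀ᶠ σ : ℝ in 𝓝[>] (1 : ℝ), 0 < Real.log (1 / (σ - 1)) := by
  filter_upwards [Ioo_mem_nhdsGT (show (1 : ℝ) < 2 by norm_num)] with σ hσ
  apply Real.log_pos
  rw [lt_div_iff₀ (sub_pos.mpr hσ.1)]
  linarith [hσ.2]

/-- A diagonal correlation sum `Σ' Re(a a̅) N^{-(w+σ)} = Σ' |a|² N^{-(w+σ)}` is `≥ 0 ≥ -ε log(1/(σ-1))`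
for `σ ∈ (1, 2)` (no summability needed: `tsum` of a non-negative family is `≥ 0`). [folklore] -/
theorem diag_nonneg {F : Type} [Field F] [NumberField F] (a : HeightOneSpectrum (𝓞 F) → ℂ) (w : ℤ)
    (ε : ℝ) (hε : 0 < ε) :
    ∀ᶠ σ : ℝ in 𝓝[>] (1 : ℝ), -(ε * Real.log (1 / (σ - 1))) ≤
      ∑' v : HeightOneSpectrum (𝓞 F),
        (a v * (starRingEnd ℂ) (a v)).re * (v.residueCard : ℝ) ^ (-((w : ℝ) + σ)) := by
  filter_upwards [eventually_log_pos] with σ hσ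
  have h0 : (0 : ℝ) ≤ ∑' v : HeightOneSpectrum (𝓞 F),
      (a v * (starRingEnd ℂ) (a v)).re * (v.residueCard : ℝ) ^ (-((w : ℝ) + σ)) := by
    refine tsum_nonneg fun v => mul_nonneg ?_ (Real.rpow_nonneg (Nat.cast_nonneg _) _)
    rw [Complex.mul_conj, Complex.ofReal_re]
    exact Complex.normSq_nonneg _
  have h1 : 0 ≤ ε * Real.log (1 / (σ - 1)) := mul_nonneg hε.le hσ.le
  linarith

section Roots

variable {R : Type*} [Field R] (f : R →+* ℂ)

/-- All roots of a divisor of a monic `Q` are roots of `Q` (after mapping to `ℂ`), hence inherit a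
common absolute value. [folklore] -/
theorem norm_roots_of_dvd {P Q : R[X]} (hQ : Q.Monic) (hPQ : P ∣ Q) {c : ℝ}
    (hc : ∀ z ∈ (Q.map f).roots, ‖z‖ = c) : ∀ z ∈ (P.map f).roots, ‖z‖ = c := fun z hz =>
  hc z (Multiset.mem_of_le
    (Polynomial.roots.le_of_dvd (hQ.map f).ne_zero (Polynomial.map_dvd f hPQ)) hz)

/-- For a monic `P` whose complex roots all have absolute value `c`, the image of `-nextCoeff P`
(the sum of the roots) has absolute value `≤ deg P · c`. [folklore] -/
theorem norm_map_neg_nextCoeff_le {P : R[X]} (hP : P.Monic) {c : ℝ}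
    (hc : ∀ z ∈ (P.map f).roots, ‖z‖ = c) : ‖f (-P.nextCoeff)‖ ≤ P.natDegree * c := by
  have hs : (P.map f).Splits := IsAlgClosed.splits _
  have h1 : f (-P.nextCoeff) = ((P.map f).roots).sum := by
    rw [map_neg, ← nextCoeff_map f.injective, hs.nextCoeff_eq_neg_sum_roots_of_monic (hP.map f),
      neg_neg]
  have h2 : ((P.map f).roots).card = P.natDegree := by
    rw [← hs.natDegree_eq_card_roots, natDegree_map_eq_of_injective f.injective]
  rw [h1]
  calc ‖((P.map f).roots).sum‖ ≤ (((P.map f).roots).map fun z => ‖z‖).sum := norm_multiset_sum_le _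
    _ = (((P.map f).roots).map fun _ => c).sum := congrArg Multiset.sum (Multiset.map_congr rfl hc)
    _ = P.natDegree * c := by
      rw [Multiset.map_const', Multiset.sum_replicate, nsmul_eq_mul, h2]

end Roots

/-! ## 4. The composition (kernel-checked, no `sorry`): DÉVISSAGE → PAIRS (HEART ∨ DIAGONAL) → ASSEMBLY → crux by name -/

/-- **The crux from the three stubs.**  Given the crux data: STUB 3 decomposes `ρ₁` and `ρ₂` at the
level of Frobenius polynomials into irreducible a.e.-unramified de Rham constituents `r i` (ranks
`d i`) and `s j` (ranks `e j`); at almost every place the traces add up and, since every root of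
`P_v(r i) ∣ P_v(ρ₁) P_v(ρ₂)` has absolute value `N(v)^{w/2}`, `‖ι tr r i(Frob_v)‖ ≤ dᵢ N(v)^{w/2}`
(and likewise for `s j`), while each product `P_v(r i) P_v(s j)` is again pure of weight `w`.
STUB 2 then reduces the crux to the pairs `(r i, s j)`: a pair with equal Frobenius traces at almost
all places has, by STUB 2 once more (with one constituent on each side), the sign of the diagonal
sum `Σ |ι tr r i|² N^{-(w+σ)} ≥ 0`; any other pair is an instance of STUB 1.  Hypotheses are, by
name, the statements of the three stubs; the conclusion is the route decl `TraceCorrelationNonneg`.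
[folklore] -/
theorem TraceCorrelationNonneg_of (h₁ : _Goal.stub_correlation_nonIsomorphic)
    (h₂ : _Goal.stub_correlation_assembly) (h₃ : _Goal.stub_frobenius_devissage) :
    TraceCorrelationNonneg := by
  intro F _ _ m₁ m₂ ℓ _ ι ρ₁ ρ₂ w hur hdR hpure
  -- STUB 3: Frobenius-level dévissage of `ρ₁` and of `ρ₂`
  obtain ⟨k₁, d, r, hr, hF₁⟩ :=
    h₃ F ℓ m₁ ρ₁ (hur.mono fun v hv => hv.1) fun v hv => (hdR v hv).1
  obtain ⟨k₂, e, s, hs, hF₂⟩ :=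
    h₃ F ℓ m₂ ρ₂ (hur.mono fun v hv => hv.2) fun v hv => (hdR v hv).2
  -- one constant dominating all the ranks of the constituents
  obtain ⟨C, hdC, heC⟩ : ∃ C : ℝ, (∀ i, (d i : ℝ) ≤ C) ∧ ∀ j, (e j : ℝ) ≤ C := by
    refine ⟨((Finset.univ.sup d : ℕ) : ℝ) + ((Finset.univ.sup e : ℕ) : ℝ), fun i => ?_, fun j => ?_⟩
    · have h1 : (d i : ℝ) ≤ ((Finset.univ.sup d : ℕ) : ℝ) := by
        exact_mod_cast Finset.le_sup (f := d) (Finset.mem_univ i)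
      have h2 : (0 : ℝ) ≤ ((Finset.univ.sup e : ℕ) : ℝ) := Nat.cast_nonneg _
      linarith
    · have h1 : (e j : ℝ) ≤ ((Finset.univ.sup e : ℕ) : ℝ) := by
        exact_mod_cast Finset.le_sup (f := e) (Finset.mem_univ j)
      have h2 : (0 : ℝ) ≤ ((Finset.univ.sup d : ℕ) : ℝ) := Nat.cast_nonneg _
      linarith
  -- trace additivity at almost every place
  have hT : ∀ᶠ v : HeightOneSpectrum (𝓞 F) in cofinite,
      (ι : PadicAlgCl ℓ ≃+* ℂ) (ρ₁.toGaloisRep.frobTrace v) =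
          ∑ i, (ι : PadicAlgCl ℓ ≃+* ℂ) ((r i).toGaloisRep.frobTrace v) ∧
        (ι : PadicAlgCl ℓ ≃+* ℂ) (ρ₂.toGaloisRep.frobTrace v) =
          ∑ j, (ι : PadicAlgCl ℓ ≃+* ℂ) ((s j).toGaloisRep.frobTrace v) := by
    filter_upwards [hF₁, hF₂] with v hv₁ hv₂
    constructor
    · rw [← map_sum]
      congr 1
      simp only [GaloisRep.frobTrace]
      rw [hv₁.1, Monic.nextCoeff_prod Finset.univ (fun i => (r i).toGaloisRep.frobCharpoly v)
        (fun i _ => (hv₁.2 i).1), Finset.sum_neg_distrib]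
    · rw [← map_sum]
      congr 1
      simp only [GaloisRep.frobTrace]
      rw [hv₂.1, Monic.nextCoeff_prod Finset.univ (fun j => (s j).toGaloisRep.frobCharpoly v)
        (fun j _ => (hv₂.2 j).1), Finset.sum_neg_distrib]
  -- the purity bound on the traces of the constituents
  have hb : ∀ᶠ v : HeightOneSpectrum (𝓞 F) in cofinite,
      (∀ i, ‖(ι : PadicAlgCl ℓ ≃+* ℂ) ((r i).toGaloisRep.frobTrace v)‖ ≤
          C * (v.residueCard : ℝ) ^ ((w : ℝ) / 2)) ∧
        ∀ j, ‖(ι : PadicAlgCl ℓ ≃+* ℂ) ((s j).toGaloisRep.frobTrace v)‖ ≤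
          C * (v.residueCard : ℝ) ^ ((w : ℝ) / 2) := by
    filter_upwards [hF₁, hF₂, hpure] with v hv₁ hv₂ hv
    have hc0 : (0 : ℝ) ≤ (v.residueCard : ℝ) ^ ((w : ℝ) / 2) :=
      Real.rpow_nonneg (Nat.cast_nonneg _) _
    have hM₁ : (ρ₁.toGaloisRep.frobCharpoly v).Monic := by
      rw [hv₁.1]
      exact monic_prod_of_monic _ _ fun i _ => (hv₁.2 i).1
    have hM₂ : (ρ₂.toGaloisRep.frobCharpoly v).Monic := by
      rw [hv₂.1]
      exact monic_prod_of_monic _ _ fun j _ => (hv₂.2 j).1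
    have hM : (ρ₁.toGaloisRep.frobCharpoly v * ρ₂.toGaloisRep.frobCharpoly v).Monic := hM₁.mul hM₂
    constructor
    · intro i
      have hdvd : (r i).toGaloisRep.frobCharpoly v ∣
          ρ₁.toGaloisRep.frobCharpoly v * ρ₂.toGaloisRep.frobCharpoly v := by
        rw [hv₁.1]
        exact dvd_mul_of_dvd_left
          (Finset.dvd_prod_of_mem (fun i => (r i).toGaloisRep.frobCharpoly v) (Finset.mem_univ i)) _
      have key := norm_map_neg_nextCoeff_le (ι : PadicAlgCl ℓ ≃+* ℂ).toRingHom (hv₁.2 i).1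
        (norm_roots_of_dvd (ι : PadicAlgCl ℓ ≃+* ℂ).toRingHom hM hdvd hv)
      rw [(hv₁.2 i).2] at key
      exact key.trans (mul_le_mul_of_nonneg_right (hdC i) hc0)
    · intro j
      have hdvd : (s j).toGaloisRep.frobCharpoly v ∣
          ρ₁.toGaloisRep.frobCharpoly v * ρ₂.toGaloisRep.frobCharpoly v := by
        rw [hv₂.1]
        exact dvd_mul_of_dvd_right
          (Finset.dvd_prod_of_mem (fun j => (s j).toGaloisRep.frobCharpoly v) (Finset.mem_univ j)) _
      have key := norm_map_neg_nextCoeff_le (ι : PadicAlgCl ℓ ≃+* ℂ).toRingHom (hv₂.2 j).1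
        (norm_roots_of_dvd (ι : PadicAlgCl ℓ ≃+* ℂ).toRingHom hM hdvd hv)
      rw [(hv₂.2 j).2] at key
      exact key.trans (mul_le_mul_of_nonneg_right (heC j) hc0)
  -- purity of each pair of constituents
  have hpp : ∀ i j, ∀ᶠ v : HeightOneSpectrum (𝓞 F) in cofinite,
      ∀ z ∈ (((r i).toGaloisRep.frobCharpoly v * (s j).toGaloisRep.frobCharpoly v).map
        (ι : PadicAlgCl ℓ ≃+* ℂ).toRingHom).roots, ‖z‖ = (v.residueCard : ℝ) ^ ((w : ℝ) / 2) := by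
    intro i j
    filter_upwards [hF₁, hF₂, hpure] with v hv₁ hv₂ hv
    have hM₁ : (ρ₁.toGaloisRep.frobCharpoly v).Monic := by
      rw [hv₁.1]
      exact monic_prod_of_monic _ _ fun i _ => (hv₁.2 i).1
    have hM₂ : (ρ₂.toGaloisRep.frobCharpoly v).Monic := by
      rw [hv₂.1]
      exact monic_prod_of_monic _ _ fun j _ => (hv₂.2 j).1
    have hdvd : (r i).toGaloisRep.frobCharpoly v * (s j).toGaloisRep.frobCharpoly v ∣
        ρ₁.toGaloisRep.frobCharpoly v * ρ₂.toGaloisRep.frobCharpoly v := by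
      rw [hv₁.1, hv₂.1]
      exact mul_dvd_mul
        (Finset.dvd_prod_of_mem (fun i => (r i).toGaloisRep.frobCharpoly v) (Finset.mem_univ i))
        (Finset.dvd_prod_of_mem (fun j => (s j).toGaloisRep.frobCharpoly v) (Finset.mem_univ j))
    exact norm_roots_of_dvd (ι : PadicAlgCl ℓ ≃+* ℂ).toRingHom (hM₁.mul hM₂) hdvd hv
  -- STUB 2: reduce to the pairs of constituents
  refine h₂ F k₁ k₂ w C (fun v => (ι : PadicAlgCl ℓ ≃+* ℂ) (ρ₁.toGaloisRep.frobTrace v))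
    (fun v => (ι : PadicAlgCl ℓ ≃+* ℂ) (ρ₂.toGaloisRep.frobTrace v))
    (fun i v => (ι : PadicAlgCl ℓ ≃+* ℂ) ((r i).toGaloisRep.frobTrace v))
    (fun j v => (ι : PadicAlgCl ℓ ≃+* ℂ) ((s j).toGaloisRep.frobTrace v)) hT hb ?_
  intro i j
  by_cases hij : ∀ᶠ v : HeightOneSpectrum (𝓞 F) in cofinite,
      (r i).toGaloisRep.frobTrace v = (s j).toGaloisRep.frobTrace v
  · -- trace-equal pair: up to finitely many places the diagonal sum of `r i`, via STUB 2 with 1 + 1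
    refine h₂ F 1 1 w C (fun v => (ι : PadicAlgCl ℓ ≃+* ℂ) ((r i).toGaloisRep.frobTrace v))
      (fun v => (ι : PadicAlgCl ℓ ≃+* ℂ) ((s j).toGaloisRep.frobTrace v))
      (fun _ v => (ι : PadicAlgCl ℓ ≃+* ℂ) ((r i).toGaloisRep.frobTrace v))
      (fun _ v => (ι : PadicAlgCl ℓ ≃+* ℂ) ((r i).toGaloisRep.frobTrace v)) ?_ ?_ ?_
    · have key : ∀ᶠ v : HeightOneSpectrum (𝓞 F) in cofinite,
          (ι : PadicAlgCl ℓ ≃+* ℂ) ((r i).toGaloisRep.frobTrace v) =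
              ∑ _x : Fin 1, (ι : PadicAlgCl ℓ ≃+* ℂ) ((r i).toGaloisRep.frobTrace v) ∧
            (ι : PadicAlgCl ℓ ≃+* ℂ) ((s j).toGaloisRep.frobTrace v) =
              ∑ _x : Fin 1, (ι : PadicAlgCl ℓ ≃+* ℂ) ((r i).toGaloisRep.frobTrace v) := by
        filter_upwards [hij] with v hv
        rw [Fin.sum_univ_one, hv]
        exact ⟨rfl, rfl⟩
      exact key
    · have key : ∀ᶠ v : HeightOneSpectrum (𝓞 F) in cofinite,
          (∀ _x : Fin 1, ‖(ι : PadicAlgCl ℓ ≃+* ℂ) ((r i).toGaloisRep.frobTrace v)‖ ≤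
              C * (v.residueCard : ℝ) ^ ((w : ℝ) / 2)) ∧
            ∀ _x : Fin 1, ‖(ι : PadicAlgCl ℓ ≃+* ℂ) ((r i).toGaloisRep.frobTrace v)‖ ≤
              C * (v.residueCard : ℝ) ^ ((w : ℝ) / 2) := by
        filter_upwards [hb] with v hv
        exact ⟨fun _ => hv.1 i, fun _ => hv.1 i⟩
      exact key
    · intro _ _ ε hε
      exact diag_nonneg (fun v => (ι : PadicAlgCl ℓ ≃+* ℂ) ((r i).toGaloisRep.frobTrace v)) w ε hε
  · -- trace-distinct pair of irreducible constituents: STUB 1 verbatim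
    exact h₁ F (d i) (e j) (hr i).1 (hs j).1 ℓ ι (r i) (s j) w (hr i).2.1 (hs j).2.1
      (((hr i).2.2.1).and ((hs j).2.2.1)) (fun v hv => ⟨(hr i).2.2.2 v hv, (hs j).2.2.2 v hv⟩)
      (hpp i j) hij

/-- By-name sanity check (an `example`, so it is not a declaration of the file): the stubs feed the
composition as they stand. -/
example : TraceCorrelationNonneg :=
  TraceCorrelationNonneg_of stub_correlation_nonIsomorphic stub_correlation_assembly
    stub_frobenius_devissage

end Summit.Langlands.Langlands.Cruxes.TraceCorrelationNonneg.Birth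

end
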